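import Literature.MathematicalPhysics.QuantumFieldTheory.Balaban1983to89.T4FirstOrderSize
import Summits.QuantumFields.BalabanUV.T4Continuum.Spine.NE7.QLa

/-!
# Spine/NE7/QLaFromNE1p — the join of rows NE7 and NE1′ BY NAME: `T4FirstOrderSize.SizeShape` (NE1′'s consumer shape for
# the D-terms of the R-operation's quotients, per tube M-cube and birth scale) × the component census ⟹ `Spine.NE7.QLa`
# with ratio `a = ρ·Λ`; in NE1′'s two typed currencies: `AbsorbedCostSize` (rate `θ₁²`) ⟹ `a = θ₁²Λ`, `FirstOrderSize`
# (rate `θ₁φ`) ⟹ `a = θ₁φΛ`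

Cell `pub-balaban-gaps` (YM blitz Y1, track G2, seat `ne7`, generation 2); text of record `run/shared/lean/pub/pub-balaban-gaps/ne/NE7.md`
v2 §4bis ∕ §7bis ∕ R24 (the NE7 × NE1′ reconciliation).  Fourth `Spine/NE7/` file (after `Targets` p339119, `QLa` p339533, `QLaBudget`
p340302); it imports ONLY the tree's `T4FirstOrderSize` (row T4-O3.E-i′ of the b2b cell = row NE1′ of this cell, per `HOME/ne/NE1.md`
§0) and `Spine.NE7.QLa`, so the join is checked against the two rows' OWN declarations.

WHAT IS PROVED ([folklore] finite-sum algebra; nothing of Bałaban's asserted):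
* `qla_of_sizeShape` — if every component `X` of a one-run ledger has `t`-discrepancy at most (its volume `wt X` in tube M-cubes) ×
  (the per-M-cube size `|s (sc X)|` of its birth scale), the sizes have NE1′'s shape `T4FirstOrderSize.SizeShape K s C w ρ`
  (`|s j| ≤ C·w j·ρ^{K−j}`, T4FirstOrderSize.lean :281) with scale weights `w j ≤ wmax`, and the ledger obeys the (0.26)-type census
  `T4RecentScale.Multiplicity wf sc wt Cw vol Λ K`, then `Spine.NE7.QLa wf sc ct c0 K vol (C·wmax·Cw) (ρ·Λ)`.
* `qla_of_absorbedCostSize` — NE1′'s SECOND-order currency `AbsorbedCostSize K cost C θ₁ g` (:360; weight `g_j²`, rate `θ₁²`;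
  [Balaban1988RG2Cluster] (2.20) p. 16's constant currency) ⟹ `QLa … (C·γ²·Cw) (θ₁²·Λ)` for couplings `g_j ≤ γ`;
  `qla_of_firstOrderSize` — the conditional-mean currency `FirstOrderSize K s C θ₁ φ g R` (:352; weight `g_j²R_j²`, rate `θ₁φ`)
  ⟹ `QLa … (C·B·Cw) (θ₁φ·Λ)` for `g_j²R_j² ≤ B`.
* The `d = 4` numbers (`Λ = L⁴` = every `j`-cube of a unit region, `θ₁ = L⁻³` = `T4LoopPullback.theta1_exact`'s `L^{1−d}`):
  `absorbedCost_rate_eq` `θ₁²Λ = L⁻²` (< 1: `Spine.NE7.rate_secondOrder_lt_one` of `QLaBudget`), `firstOrder_rate_eq` `θ₁φΛ = L·φ`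
  (< 1 iff `φ < L⁻¹`: `firstOrder_rate_lt_one_iff`) — and `T4FirstOrderSize.supSize_product_eq`'s UNCHARGED sup (rate `θ₁`) gives
  `θ₁Λ = L > 1` (`Spine.NE7.one_lt_rate_firstOrder`).  So the letter `a < 1` of route 1's END (`TermwiseResidualWitness.tBracket_le`'s
  `hsize` = (QL-a)) is MET in NE1′'s absorbed-cost currency, met in its conditional-mean currency iff the flatness factor beats `1∕L`,
  and FAILS for the uncharged first-order sup: (QL-a) is NE1′'s size mechanism read on field-independent constants — ONE item, two rows.

HONEST FRAMING.  `SizeShape` ∕ `AbsorbedCostSize` ∕ `FirstOrderSize` are NE1′'s HYPOTHESIS SHAPES (T4-REF-O3 V4∕V5, NOT PRINTED — the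
D-terms are terms of the cell's dressed R-operation, which [Balaban1989LargeFieldII] p. 356 defers); `QLa` is NE7's (NOT PRINTED); this
file proves only that the former, per component, sum to the latter.  Which density∕insert produces `SizeShape` (the (1.100) quotient of
[Balaban1989LargeFieldI] p. 201; `MeanVanishes` ⇐ `T4AdInvariant`, `CondMeanSuppression`, obligations (α)(β)(γ) of the b2b record
`t4/T4-EST-O3Ei1.md`) is row NE1′'s open content and is NOT touched.  NE7 NOT proved; spine 0∕9; fixed finite T⁴ — NOT ℝ⁴, NOT a mass
gap, NOT Clay.  No census value changes beyond NE7.md v2's re-booking (two rows → one shared item).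
-/

noncomputable section

open Finset
open scoped BigOperators

namespace Summit.QuantumFields.BalabanUV.T4Continuum.Spine.NE7

open Literature.MathematicalPhysics.QuantumFieldTheory.Balaban1983to89
open Literature.MathematicalPhysics.QuantumFieldTheory.Balaban1983to89.T4FirstOrderSize
open Literature.MathematicalPhysics.QuantumFieldTheory.Balaban1983to89.T4RecentScale (Multiplicity)

variable {D : Type*}

/-- [bookkeeping] **NE1′'s `SizeShape` PER COMPONENT × THE CENSUS ⟹ NE7's `QLa` WITH `a = ρ·Λ`.**  Components `X ∈ wf` with birth
scales `sc X`, volumes `wt X ≥ 0` (in tube M-cubes), `t`-discrepancies `|ct X − c0 X| ≤ |s (sc X)|·wt X`; per-M-cube sizes of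
shape `SizeShape K s C w ρ` with `0 ≤ w j ≤ wmax`; census `Σ_{sc X = j} wt X ≤ Cw·vol·Λ^{K−j}`.  Then
`Σ_{sc X = j} |ct X − c0 X| ≤ vol·(C·wmax·Cw)·(ρΛ)^{K−j}` for every `j ≤ K`. [folklore] -/
theorem qla_of_sizeShape {wf : Finset D} {sc : D → ℕ} {wt ct c0 : D → ℝ} {K : ℕ} {s w : ℕ → ℝ}
    {C ρ wmax Cw vol Λ : ℝ} (hX : ∀ X ∈ wf, |ct X - c0 X| ≤ |s (sc X)| * wt X)
    (hS : SizeShape K s C w ρ) (hw : ∀ j, j ≤ K → 0 ≤ w j ∧ w j ≤ wmax) (hC : 0 ≤ C) (hρ : 0 ≤ ρ)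
    (hwt : ∀ X ∈ wf, 0 ≤ wt X) (hM : Multiplicity wf sc wt Cw vol Λ K) :
    QLa wf sc ct c0 K vol (C * wmax * Cw) (ρ * Λ) := by
  intro j hj
  have hsj : |s j| ≤ C * wmax * ρ ^ (K - j) :=
    (hS j hj).trans <| by
      have := mul_le_mul_of_nonneg_left (hw j hj).2 hC
      nlinarith [pow_nonneg hρ (K - j), (hw j hj).1]
  have hsum0 : 0 ≤ ∑ X ∈ wf with sc X = j, wt X := sum_nonneg fun X hX => hwt X (mem_filter.mp hX).1
  calc ∑ X ∈ wf with sc X = j, |ct X - c0 X|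
      ≤ ∑ X ∈ wf with sc X = j, |s j| * wt X := sum_le_sum fun X hXmem => by
          obtain ⟨hXw, hXj⟩ := mem_filter.mp hXmem
          simpa only [hXj] using hX X hXw
    _ = |s j| * ∑ X ∈ wf with sc X = j, wt X := (mul_sum _ _ _).symm
    _ ≤ (C * wmax * ρ ^ (K - j)) * (Cw * vol * Λ ^ (K - j)) :=
        mul_le_mul hsj (hM j hj) hsum0 ((abs_nonneg _).trans hsj)
    _ = vol * (C * wmax * Cw * (ρ * Λ) ^ (K - j)) := by rw [mul_pow]; ring

/-- [bookkeeping] **IN NE1′'s ABSORBED-COST (SECOND-ORDER) CURRENCY**: `AbsorbedCostSize K cost C θ₁ g` (weight `g_j²`, rate `θ₁²`) with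
couplings `0 ≤ g_j ≤ γ` ⟹ `QLa … vol (C·γ²·Cw) (θ₁²·Λ)`. [folklore] -/
theorem qla_of_absorbedCostSize {wf : Finset D} {sc : D → ℕ} {wt ct c0 : D → ℝ} {K : ℕ} {cost g : ℕ → ℝ}
    {C θ₁ γ Cw vol Λ : ℝ} (hX : ∀ X ∈ wf, |ct X - c0 X| ≤ |cost (sc X)| * wt X)
    (hS : AbsorbedCostSize K cost C θ₁ g) (hg : ∀ j, j ≤ K → 0 ≤ g j ∧ g j ≤ γ) (hC : 0 ≤ C)
    (hwt : ∀ X ∈ wf, 0 ≤ wt X) (hM : Multiplicity wf sc wt Cw vol Λ K) :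
    QLa wf sc ct c0 K vol (C * γ ^ 2 * Cw) (θ₁ ^ 2 * Λ) :=
  qla_of_sizeShape hX hS (fun j hj => ⟨sq_nonneg _, pow_le_pow_left₀ (hg j hj).1 (hg j hj).2 2⟩) hC (sq_nonneg _)
    hwt hM

/-- [bookkeeping] **IN NE1′'s CONDITIONAL-MEAN (FIRST-ORDER, SUPPRESSED) CURRENCY**: `FirstOrderSize K s C θ₁ φ g R` (weight `g_j²R_j²`,
rate `θ₁φ`) with `g_j²R_j² ≤ B` and `0 ≤ θ₁φ` ⟹ `QLa … vol (C·B·Cw) (θ₁φ·Λ)`. [folklore] -/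
theorem qla_of_firstOrderSize {wf : Finset D} {sc : D → ℕ} {wt ct c0 : D → ℝ} {K : ℕ} {s g R : ℕ → ℝ}
    {C θ₁ φ B Cw vol Λ : ℝ} (hX : ∀ X ∈ wf, |ct X - c0 X| ≤ |s (sc X)| * wt X)
    (hS : FirstOrderSize K s C θ₁ φ g R) (hB : ∀ j, j ≤ K → g j ^ 2 * R j ^ 2 ≤ B) (hC : 0 ≤ C) (hθφ : 0 ≤ θ₁ * φ)
    (hwt : ∀ X ∈ wf, 0 ≤ wt X) (hM : Multiplicity wf sc wt Cw vol Λ K) :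
    QLa wf sc ct c0 K vol (C * B * Cw) (θ₁ * φ * Λ) :=
  qla_of_sizeShape hX hS (fun j hj => ⟨mul_nonneg (sq_nonneg _) (sq_nonneg _), hB j hj⟩) hC hθφ hwt hM

/-! ## The `d = 4` ratios: `Λ = L⁴`, `θ₁ = L⁻³` -/

/-- [bookkeeping] Absorbed-cost currency: `a = θ₁²·Λ = (L⁻³)²·L⁴ = L⁻²` (the `< 1` is `QLaBudget`'s `rate_secondOrder_lt_one`).
[folklore] -/
theorem absorbedCost_rate_eq {L : ℝ} (hL : L ≠ 0) : (L⁻¹ ^ 3) ^ 2 * L ^ 4 = (L ^ 2)⁻¹ := by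
  field_simp

/-- [bookkeeping] Conditional-mean currency: `a = θ₁φ·Λ = L⁻³·φ·L⁴ = L·φ`. [folklore] -/
theorem firstOrder_rate_eq {L : ℝ} (hL : L ≠ 0) (φ : ℝ) : L⁻¹ ^ 3 * φ * L ^ 4 = L * φ := by
  field_simp

/-- [bookkeeping] … so in that currency the letter `a < 1` holds IFF the flatness factor beats the block size, `φ < L⁻¹` (`L > 0`,
`φ ≥ 0`): the located quantitative condition under which NE1′'s `FirstOrderSize` alone (without the absorbed-cost re-charge) would
already give (QL-a). [folklore] -/
theorem firstOrder_rate_lt_one_iff {L φ : ℝ} (hL : 0 < L) : L⁻¹ ^ 3 * φ * L ^ 4 < 1 ↔ φ < L⁻¹ := by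
  rw [firstOrder_rate_eq hL.ne' φ, mul_comm, ← lt_div_iff₀ hL, one_div]

/-- SANITY (the join fires on explicit data): one component of birth scale `0` and volume `1` with discrepancy `|cost 0|`, sizes of
absorbed-cost shape with `C = 1`, `g = 1`, census `Cw = vol = 1`; conclusion `QLa` with constants `1·1²·1` and rate `θ₁²·Λ`.
[folklore] -/
example (K : ℕ) (θ₁ Λ : ℝ) (hΛ : 1 ≤ Λ) (cost : ℕ → ℝ) (hS : AbsorbedCostSize K cost 1 θ₁ fun _ => 1) :
    QLa ({()} : Finset Unit) (fun _ => 0) (fun _ => cost 0) (fun _ => 0) K 1 (1 * 1 ^ 2 * 1) (θ₁ ^ 2 * Λ) := by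
  refine qla_of_absorbedCostSize (wt := fun _ => 1) (fun X _ => by simp) hS
    (fun j _ => ⟨zero_le_one, le_rfl⟩) zero_le_one (fun _ _ => zero_le_one) fun j _ => ?_
  calc ∑ X ∈ ({()} : Finset Unit) with (fun _ : Unit => 0) X = j, (fun _ : Unit => (1 : ℝ)) X
      ≤ ∑ X ∈ ({()} : Finset Unit), (fun _ : Unit => (1 : ℝ)) X :=
        sum_le_sum_of_subset_of_nonneg (filter_subset _ _) fun _ _ _ => zero_le_one
    _ = 1 := by simp
    _ ≤ 1 * 1 * Λ ^ (K - j) := by rw [one_mul, one_mul]; exact one_le_pow₀ hΛ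

end Summit.QuantumFields.BalabanUV.T4Continuum.Spine.NE7

end
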